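import Summits.BirchSwinnertonDyer.BirchSwinnertonDyer.Theorems.ResidualThetaTransportAtTwoSignedMuVanishingAtTwoPlusCuspSpanGenerationTwoPrimesTools
import Summits.BirchSwinnertonDyer.BirchSwinnertonDyer.Theorems.ResidualThetaTransportAtTwoThetaLayerLambdaCongruenceAtTwoCuspSpanCharacterOdd
import Summits.BirchSwinnertonDyer.BirchSwinnertonDyer.Theorems.ResidualThetaTransportAtTwoSignedMuVanishingAtTwoPlusCuspSpanNamed
import HarnessLib

/-!
# Node (G′)_N = `CuspSpanEvenAtTwo N` (item 27436; cruxes Kμ⁺ 20689 / Kan⁺ 20688 / 21437): GENERATION AT THE COMPOSITE LEVELS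
# `N = p·q` and `N = p²·q` — `Γ₀(N)` is generated by its small-trace elements and its `|b| = 1` elements, uniformly, no certificate;
# hence (§5, with rtt-p3-w4's `B₁`-character theorem at every odd level) **`CuspSpanEvenAtTwo (p^a·q)` UNCONDITIONALLY for odd primes
# `p, q` and `a ≤ 2`**, and FLAT at every such conductor

Cell `bsd-wall`, lead `bsd-wall-rtt-p4` g9 (crux Kμ⁺ stmt-BirchSwinnertonDyer-20689, line `birth`, stub `stub_flatMuZeroAtTwo` ⟸ node 27436).
THEOREMS ONLY (no `def`, no named fact, no `sorry`); helper `--supports` the crux; BSD is not proved by this. This is the first UNIFORM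
composite family of the generation statement «Lemma P» of `Cruxes/ThetaLayerLambdaCongruenceAtTwo/Lines/birth-generation.md` §3.3 (rtt-p3 g9:
Stallings-certified for every tested `N = p^a q^b`, FAILING at `105 = 3·5·7` and `135 = 3³·5`), and it is the «pure generation» half that
rtt-p3-w4 g2 handed off for composite `N` (STATUS 12:59:41Z (D)): at these levels (G″)_N follows from «the `B₁`-character of every admissible
`χ` is a character of `(ℤ/N)ˣ`» (§4), the half being proved by the rtt-p3 width seats.

THEOREM (`TwoPrimes.chi_eq_zero_of_forall_b1`). Let `N = p^a·q` with `p, q` primes and `a ∈ {1, 2}` (`p = q` allowed: then `N ∈ {p², p³}` and the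
two-bad-parents case below is empty). Every `χ : Γ₀(N) → ZMod 2` which is
additive, kills the elements of trace `0, ±1, ±2`, and kills every element with upper-right entry `±1`, vanishes identically. (The composite
twin of `chi_eq_zero_of_forall_b1`, whose hypothesis (SUCC) «of two consecutive integers one is a unit mod `N`» holds only at prime powers.)

PROOF (Farey parents + ONE parabolic at a bad cusp; no Hecke theory, no certificate). Induct on `|d(γ)|`. The column `x = (b, d) = γe₂` has
`d` a unit mod `N` («good»). `|d| ≤ 1` is a small-trace element up to a power of `T`. For `d ≥ 2` take the Farey parents `y = (b′, d′)`,
`y′ = x − y` (`b d′ − d b′ = 1`, `0 < d′, d − d′ < d`). Two elements of `Γ₀(N)` whose second columns `x₁, x₂` satisfy `|det(x₁, x₂)| = 1` have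
the same `χ`-value (`γ₁⁻¹γ₂` has `|b| = 1`, §1); so if a parent is good the induction hypothesis transfers. If BOTH parents are bad, then —
the parents' `d`'s being coprime and `N` having exactly the primes `p, q` — one of them, `y`, has `p ∣ d_y`, `q ∤ d_y` and the other has
`q ∣ d_{y′}`, `p ∤ d_{y′}`; then `z := y′ − y` is GOOD with `|d_z| < d` (induction hypothesis applies), the PARABOLIC
`P = I + w·y·yᵀJ` (`J` the symplectic form; lower-left entry `−w d_y²`, in `Γ₀(N)` as soon as `N ∣ w d_y²`, i.e. `w = ±q` BECAUSE `a ≤ 2`)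
sends `z` to `z + q·y`, and the walk `z + j·y`, `j = q, q−1, …, 2`, consists of good columns (`d = d_{y′} + (j−1)d_y`, and `q ∤ j − 1`),
consecutive ones Farey-adjacent, ending at `z + 2y = x`. (For `a ≥ 3`, for `p²q²` and for three primes this local walk is obstructed — the
levels `135`, `225`, `105` — matching the certificates.)

§5 THE NODE (`TwoPrimes.cuspSpanEvenAtTwo_twoPrimes`, `…_prime_mul_prime`, `…_prime_sq_mul_prime`, `flatAtTwo_of_conductor_twoPrimes`):
composing §3 with rtt-p3-w4 g2's `cuspSpanEvenAtTwo_of_forall_b1_odd` (p638351 `…CuspSpanCharacterOdd`: at every odd level the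
`B₁`-character of an admissible `χ` is a character, so the node is EXACTLY `B₁`-generation) gives `CuspSpanEvenAtTwo N` for every
`N = p^a q` with `p, q` odd primes and `a ≤ 2` — the first composite levels of the node with no certificate and no ERH — and FLAT
(`2 ∤ L⁻` for every Pollack pair at `2`) for every `W` good supersingular at `2` with `a₂ = 0` of such a conductor.

§4 COMPOSITION (`TwoPrimes.cuspSpanTrace_of_b1Character`, `TwoPrimes.cuspSpanEvenAtTwo_of_b1Character`; kept as the explicit interface): at these levels, if every ADMISSIBLE
`χ` (additive, small-trace-killed, `4^k`-classes killed) has `B₁`-values `χ β = ψ(d̄ β)` (`b(β) = −1`) for some `ψ` multiplicative-to-additive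
on the units of `ZMod N`, then the trace form (G″)_N holds and hence the named node `CuspSpanEvenAtTwo N`. Key bookkeeping: for every
`γ = (a b; c d) ∈ Γ₀(N)` the element `β_γ := (a, −1; −bc, d)` lies in `Γ₀(N)`, has `b = −1`, the SAME trace and the SAME `d`; so `ψ ∘ d̄` kills
every small-trace element and every `4^k`-class, and `χ + ψ ∘ d̄` satisfies the hypotheses of the theorem.

References: H. Rademacher, Abh. Math. Sem. Hamburg 7 (1929) (generators of `Γ₀(p)`) [Rademacher1929]; R. S. Kulkarni, Amer. J. Math. 113
(1991) 1053–1133 (Farey symbols) [Kulkarni1991]; A. W. Knapp, *Elliptic curves* (1992) Prop. 11.22 [Knapp1993]; R. Pollack, Duke Math. J.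
118 (2003) Conj. 6.3 [Pollack2003].
-/

set_option autoImplicit false
set_option linter.dupNamespace false

noncomputable section

open scoped MatrixGroups

open CongruenceSubgroup WeierstrassCurve Literature.NumberTheory.EllipticCurves
  Literature.NumberTheory.EllipticCurves.ModularForms Literature.NumberTheory.EllipticCurves.Rank1Residual
  Summit.BirchSwinnertonDyer.Rank1Residual.Supersingular

namespace Summit.BirchSwinnertonDyer.BirchSwinnertonDyer.Theorems.SignedMuAtTwo

namespace TwoPrimes

variable {N : ℕ} {χ : Gamma0 N → ZMod 2}

/-! ## §3. The generation theorem at `N = p^a q`, `a ≤ 2` -/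

/-- **GENERATION AT `N = p·q` AND `N = p²·q`.** For `N = p^a q` (`p, q` primes, `a ∈ {1,2}`; `p = q` allowed): every additive `χ : Γ₀(N) → ZMod 2` that kills
the elements of trace `0, ±1, ±2` and the elements with upper-right entry `±1` is identically `0`. Equivalently `Γ₀(N)` is generated, modulo
the kernel of every such `χ`, by its small-trace elements and its `|b| = 1` elements — «Lemma P» of the (T_N) programme at these levels,
uniformly (the composite twin of `chi_eq_zero_of_forall_b1`, without (SUCC)). Proof in the module docstring (Farey parents; when both are bad,
one parabolic `P = I + w y yᵀJ` at the `p`-parent `y` with `w = ±q`, and a walk of `q − 2` Farey steps).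
[cite: Kulkarni1991, §2 (Farey symbols)] [cite: Rademacher1929, §1] -/
theorem chi_eq_zero_of_forall_b1 {p q a : ℕ} (hp : p.Prime) (hq : q.Prime) (ha1 : 1 ≤ a) (ha2 : a ≤ 2)
    (hN : N = p ^ a * q)
    (hadd : ∀ γ δ : Gamma0 N, χ (γ * δ) = χ γ + χ δ)
    (hsmall : ∀ γ : Gamma0 N, ((γ : SL(2, ℤ)) 0 0 + (γ : SL(2, ℤ)) 1 1).natAbs ≤ 2 → χ γ = 0)
    (hB1 : ∀ β : Gamma0 N, ((β : SL(2, ℤ)) 0 1).natAbs = 1 → χ β = 0) :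
    ∀ γ : Gamma0 N, χ γ = 0 := by
  have hp' : Prime (p : ℤ) := Nat.prime_iff_prime_int.mp hp
  have hq' : Prime (q : ℤ) := Nat.prime_iff_prime_int.mp hq
  have hq2 : 2 ≤ q := hq.two_le
  have hN2 : 2 ≤ N := by
    rw [hN]
    exact le_trans hq2 (Nat.le_mul_of_pos_left q (pow_pos hp.pos a))
  -- strong induction on `|d|`
  suffices h : ∀ n : ℕ, ∀ γ : Gamma0 N, ((γ : SL(2, ℤ)) 1 1).natAbs = n → χ γ = 0 from fun γ ↦ h _ γ rfl
  intro n
  induction n using Nat.strong_induction_on with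
  | _ n ih =>
  -- first the case `d > 0`
  have core : ∀ γ : Gamma0 N, 0 < (γ : SL(2, ℤ)) 1 1 → ((γ : SL(2, ℤ)) 1 1).natAbs = n → χ γ = 0 := by
    intro γ hdpos hn
    set b := (γ : SL(2, ℤ)) 0 1 with hbdef
    set d := (γ : SL(2, ℤ)) 1 1 with hddef
    rcases Nat.lt_or_ge n 2 with hlt | hge
    · exact chi_eq_zero_of_natAbs_d_le_one hN2 hadd hsmall γ (by rw [← hddef, hn]; omega)
    · have hd2 : 2 ≤ d := by omega
      have hdet : (γ : SL(2, ℤ)) 0 0 * d - b * (γ : SL(2, ℤ)) 1 0 = 1 := by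
        have := Matrix.SpecialLinearGroup.det_coe (γ : SL(2, ℤ))
        rwa [Matrix.det_fin_two] at this
      have hcop : IsCoprime b d := ⟨-(γ : SL(2, ℤ)) 1 0, (γ : SL(2, ℤ)) 0 0, by linear_combination hdet⟩
      -- Farey parent `y = (b', d')` with `b d' - d b' = 1`, `0 < d' < d`
      obtain ⟨u, v, huv⟩ := hcop
      -- `u * b + v * d = 1`; the parent is `(d', b') = (u, -v)` shifted by a multiple of `(b, d)`
      set k := u / d with hkdef
      set d' := u % d with hd'def
      set b' := -v - k * b with hb'def
      have hud : d * k + d' = u := Int.mul_ediv_add_emod u d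
      have hdet' : b * d' - d * b' = 1 := by
        rw [hb'def]
        have : d' = u - d * k := by linear_combination hud
        rw [this]
        linear_combination huv
      have hd'nn : 0 ≤ d' := Int.emod_nonneg _ (by omega)
      have hd'lt : d' < d := Int.emod_lt_of_pos _ (by omega)
      have hd'pos : 0 < d' := by
        rcases lt_or_eq_of_le hd'nn with h | h
        · exact h
        · exfalso
          rw [← h, mul_zero, zero_sub] at hdet'
          -- `-(d * b') = 1` with `d ≥ 2`
          have h1 := congrArg Int.natAbs hdet'
          rw [Int.natAbs_neg, Int.natAbs_mul] at h1
          have := Nat.eq_one_of_mul_eq_one_right (by simpa using h1)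
          omega
      -- coprimality of the parents and of the columns used below
      have hcop_y : IsCoprime b' d' := ⟨-d, b, by linear_combination hdet'⟩
      have hcop_y' : IsCoprime (b - b') (d - d') := ⟨d', -b', by linear_combination hdet'⟩
      -- Case A: the parent `y` is good
      by_cases hgy : IsCoprime d' (N : ℤ)
      · obtain ⟨γy, hy01, hy11⟩ := exists_gamma0_secondCol (N := N) b' d' hcop_y hgy
        have hχy : χ γy = 0 := ih d'.natAbs (by rw [← hn]; omega) γy (by rw [hy11])
        rw [← hχy]
        refine (chi_eq_of_secondCol hadd hsmall hB1 γy γ ?_).symm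
        rw [hy01, hy11, ← hbdef, ← hddef]
        have : d' * b - b' * d = 1 := by linear_combination hdet'
        rw [this]; rfl
      -- Case A': the parent `y' = x - y` is good
      by_cases hgy' : IsCoprime (d - d') (N : ℤ)
      · obtain ⟨γy, hy01, hy11⟩ := exists_gamma0_secondCol (N := N) (b - b') (d - d') hcop_y' hgy'
        have hχy : χ γy = 0 := ih (d - d').natAbs (by rw [← hn]; omega) γy (by rw [hy11])
        rw [← hχy]
        refine (chi_eq_of_secondCol hadd hsmall hB1 γy γ ?_).symm
        rw [hy01, hy11, ← hbdef, ← hddef]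
        have : (d - d') * b - (b - b') * d = -1 := by linear_combination (-1 : ℤ) * hdet'
        rw [this]; rfl
      -- Case B: both parents are bad. The walk, for a `p`-parent `(b₁, d₁)` with `b d₁ - d b₁ = e = ±1`.
      have walk : ∀ (b₁ d₁ e : ℤ), (e = 1 ∨ e = -1) → b * d₁ - d * b₁ = e → 0 < d₁ → d₁ < d →
          (p : ℤ) ∣ d₁ → ¬ (q : ℤ) ∣ d₁ → (q : ℤ) ∣ (d - d₁) → ¬ (p : ℤ) ∣ (d - d₁) → χ γ = 0 := by
        intro b₁ d₁ e he hdet₁ hd₁pos hd₁lt hpd₁ hqd₁ hqd₂ hpd₂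
        have he2 : e * e = 1 := by rcases he with h | h <;> rw [h] <;> norm_num
        -- `z = x - 2y`
        set z₁ := b - 2 * b₁ with hz₁
        set z₂ := d - 2 * d₁ with hz₂
        -- goodness of the walk columns `z + j y`, `j = 0` and `2 ≤ j ≤ q`
        have goodj : ∀ j : ℤ, (j = 0 ∨ (2 ≤ j ∧ j ≤ q)) → IsCoprime (z₂ + j * d₁) (N : ℤ) := by
          intro j hj
          rw [isCoprime_iff_not_dvd hp hq ha1 hN]
          have ez : z₂ + j * d₁ = (d - d₁) + (j - 1) * d₁ := by rw [hz₂]; ring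
          rw [ez]
          constructor
          · intro h
            have : (p : ℤ) ∣ d - d₁ := by
              have := dvd_sub h (hpd₁.mul_left (j - 1))
              rwa [add_sub_cancel_right] at this
            exact hpd₂ this
          · intro h
            have h2 : (q : ℤ) ∣ (j - 1) * d₁ := by
              have := dvd_sub h hqd₂
              rwa [add_sub_cancel_left] at this
            rcases hq'.dvd_or_dvd h2 with h3 | h3
            · -- `q ∣ j - 1` is impossible for `j = 0` (`q ≥ 2`) and for `2 ≤ j ≤ q`
              rcases hj with rfl | ⟨hj2, hjq⟩
              · have : (q : ℤ) ∣ 1 := by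
                  have := h3.neg_right; rwa [show -((0 : ℤ) - 1) = 1 by ring] at this
                exact hq'.not_dvd_one this
              · obtain ⟨m, hm⟩ := h3
                have hm1 : 0 < m := by nlinarith
                have hm2 : m < 1 := by nlinarith
                omega
            · exact hqd₁ h3
        have hcop_j : ∀ j : ℤ, IsCoprime (z₁ + j * b₁) (z₂ + j * d₁) := fun j ↦
          ⟨e * d₁, -(e * b₁), by rw [hz₁, hz₂]; linear_combination e * hdet₁ + he2⟩
        -- `γ_z`, killed by the induction hypothesis
        obtain ⟨γz, hz01, hz11⟩ :=
          exists_gamma0_secondCol (N := N) (z₁ + 0 * b₁) (z₂ + 0 * d₁) (hcop_j 0) (goodj 0 (Or.inl rfl))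
        have hχz : χ γz = 0 := ih (z₂ + 0 * d₁).natAbs (by rw [← hn, hz₂]; omega) γz (by rw [hz11])
        -- the parabolic `P` with `P z = z + q y`: `w = -e q`
        have hNP : (N : ℤ) ∣ e * q * d₁ ^ 2 := by
          have := dvd_mul_sq (p := p) ha2 hN hpd₁
          obtain ⟨m, hm⟩ := this
          exact ⟨e * m, by linear_combination e * hm⟩
        obtain ⟨P, hP00, hP01, hP10, hP11⟩ := ThetaLayerLambdaCongruenceAtTwo.exists_gamma0_entries (N := N)
          (1 + e * q * b₁ * d₁) (-(e * q * b₁ ^ 2)) (e * q * d₁ ^ 2) (1 - e * q * b₁ * d₁) (by ring) hNP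
        have hP : χ P = 0 := hsmall P (by rw [hP00, hP11]; ring_nf; rfl)
        have hPz01 : ((P * γz : Gamma0 N) : SL(2, ℤ)) 0 1 = z₁ + q * b₁ := by
          rw [gamma0_mul_apply_zero_one, hP00, hP01, hz01, hz11, hz₁, hz₂]
          linear_combination (e * q * b₁) * hdet₁ + (q * b₁) * he2
        have hPz11 : ((P * γz : Gamma0 N) : SL(2, ℤ)) 1 1 = z₂ + q * d₁ := by
          rw [gamma0_mul_apply_one_one', hP10, hP11, hz01, hz11, hz₁, hz₂]
          linear_combination (e * q * d₁) * hdet₁ + (q * d₁) * he2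
        have hχPz : χ (P * γz) = 0 := by rw [hadd, hP, hχz, add_zero]
        -- the walk: for `m + 2 ≤ q`, every element with second column `z + (q - m) y` is killed
        have hwalk : ∀ m : ℕ, m + 2 ≤ q → ∀ γ'' : Gamma0 N,
            (γ'' : SL(2, ℤ)) 0 1 = z₁ + ((q : ℤ) - m) * b₁ → (γ'' : SL(2, ℤ)) 1 1 = z₂ + ((q : ℤ) - m) * d₁ → χ γ'' = 0 := by
          intro m
          induction m with
          | zero =>
            intro _ γ'' h01 h11
            rw [← hχPz]
            refine (chi_eq_of_secondCol hadd hsmall hB1 (P * γz) γ'' ?_).symm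
            rw [hPz01, hPz11, h01, h11]
            push_cast
            ring_nf
            norm_num
          | succ m ihm =>
            intro hm γ'' h01 h11
            -- the previous column `z + (q - m) y` is good: take an element there, killed by `ihm`
            have hjm : (2 : ℤ) ≤ (q : ℤ) - m ∧ (q : ℤ) - m ≤ q := ⟨by omega, by omega⟩
            obtain ⟨γ₃, h₃01, h₃11⟩ := exists_gamma0_secondCol (N := N) (z₁ + ((q : ℤ) - m) * b₁)
              (z₂ + ((q : ℤ) - m) * d₁) (hcop_j _) (goodj _ (Or.inr hjm))
            have hχ₃ : χ γ₃ = 0 := ihm (by omega) γ₃ h₃01 h₃11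
            rw [← hχ₃]
            refine (chi_eq_of_secondCol hadd hsmall hB1 γ₃ γ'' ?_).symm
            rw [h₃01, h₃11, h01, h11, hz₁, hz₂]
            push_cast
            have : (d - 2 * d₁ + ((q : ℤ) - m) * d₁) * (b - 2 * b₁ + ((q : ℤ) - (m + 1)) * b₁) -
                (b - 2 * b₁ + ((q : ℤ) - m) * b₁) * (d - 2 * d₁ + ((q : ℤ) - (m + 1)) * d₁) = e := by
              linear_combination hdet₁
            rw [this]
            rcases he with h | h <;> rw [h] <;> norm_num
        -- at `m = q - 2` the column is `z + 2 y = x`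
        refine hwalk (q - 2) (by omega) γ ?_ ?_
        · rw [← hbdef, hz₁]; push_cast [Nat.cast_sub hq2]; ring
        · rw [← hddef, hz₂]; push_cast [Nat.cast_sub hq2]; ring
      -- dispatch Case B on which parent is the `p`-parent
      have hcop_dd : IsCoprime d' (d - d') := ⟨b - b', -b', by linear_combination hdet'⟩
      rcases split_of_bad_bad hp hq ha1 hN hcop_dd hgy hgy' with ⟨h1, h2, h3, h4⟩ | ⟨h1, h2, h3, h4⟩
      · exact walk b' d' 1 (Or.inl rfl) hdet' hd'pos hd'lt h1 h2 h3 h4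
      · refine walk (b - b') (d - d') (-1) (Or.inr rfl) (by linear_combination (-1 : ℤ) * hdet') (by omega) (by omega)
          h1 h2 ?_ ?_
        · rw [sub_sub_cancel]; exact h3
        · rw [sub_sub_cancel]; exact h4
  -- general `γ`: reduce to `d > 0` by the `−I` twist
  intro γ hn
  rcases lt_trichotomy ((γ : SL(2, ℤ)) 1 1) 0 with hneg | hzero | hpos
  · obtain ⟨γ', -, h11, hχ⟩ := exists_neg hadd hsmall γ
    rw [← hχ]
    exact core γ' (by rw [h11]; omega) (by rw [h11, Int.natAbs_neg, hn])
  · exact chi_eq_zero_of_natAbs_d_le_one hN2 hadd hsmall γ (by rw [hzero]; simp)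
  · exact core γ hpos hn

/-! ## §4. Composition: «the `B₁`-character is a character» ⟹ (G″)_N ⟹ `CuspSpanEvenAtTwo N` at these levels -/

/-- **The diagonal companion.** For every `γ = (a b; c d) ∈ Γ₀(N)` the matrix `β_γ = (a, −1; −bc, d)` lies in `Γ₀(N)`: it has upper-right
entry `−1`, the SAME trace and the SAME lower-right entry as `γ`. [folklore] -/
theorem exists_b_neg_one_companion (γ : Gamma0 N) :
    ∃ β : Gamma0 N, (β : SL(2, ℤ)) 0 1 = -1 ∧ (β : SL(2, ℤ)) 0 0 = (γ : SL(2, ℤ)) 0 0 ∧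
      (β : SL(2, ℤ)) 1 1 = (γ : SL(2, ℤ)) 1 1 := by
  have hdet : (γ : SL(2, ℤ)) 0 0 * (γ : SL(2, ℤ)) 1 1 - (γ : SL(2, ℤ)) 0 1 * (γ : SL(2, ℤ)) 1 0 = 1 := by
    have := Matrix.SpecialLinearGroup.det_coe (γ : SL(2, ℤ))
    rwa [Matrix.det_fin_two] at this
  have hcN : (N : ℤ) ∣ (γ : SL(2, ℤ)) 1 0 := by
    have h := γ.2
    rw [Gamma0_mem] at h
    exact (ZMod.intCast_zmod_eq_zero_iff_dvd _ N).mp h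
  obtain ⟨β, h00, h01, -, h11⟩ := ThetaLayerLambdaCongruenceAtTwo.exists_gamma0_entries (N := N)
    ((γ : SL(2, ℤ)) 0 0) (-1) (-((γ : SL(2, ℤ)) 0 1 * (γ : SL(2, ℤ)) 1 0)) ((γ : SL(2, ℤ)) 1 1)
    (by linear_combination hdet) (by exact (hcN.mul_left _).neg_right)
  exact ⟨β, h01, h00, h11⟩

/-- **(G″)_N from the `B₁`-character, at `N = p·q` and `N = p²·q`.** If at such a level every ADMISSIBLE `χ` (additive, killing the elements
of trace `0, ±1, ±2` and the elements with lower-right entry `±4^k`, `k ≥ 1`) has `B₁`-values of the form `χ β = ψ(d̄ β)` (all `β` with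
upper-right entry `−1`) for some `ψ : ZMod N → ZMod 2` multiplicative-to-additive on units, then every admissible `χ` IS `ψ ∘ d̄` — the trace
form (G″)_N of the node. Proof: `χ + ψ ∘ d̄` is additive (`d̄` is multiplicative on `Γ₀(N)`), kills the small-trace elements and the `B₁`
elements (by the diagonal companion `β_γ`, `ψ ∘ d̄` kills whatever `χ` kills among elements determined by their diagonal), hence vanishes by
`chi_eq_zero_of_forall_b1`. [cite: Pollack2003, Conj. 6.3] [cite: Kulkarni1991, §2] -/
theorem cuspSpanTrace_of_b1Character {p q a : ℕ} (hp : p.Prime) (hq : q.Prime) (ha1 : 1 ≤ a) (ha2 : a ≤ 2)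
    (hN : N = p ^ a * q)
    (hF : ∀ χ : Gamma0 N → ZMod 2,
      (∀ γ δ : Gamma0 N, χ (γ * δ) = χ γ + χ δ) →
      (∀ γ : Gamma0 N, ((γ : SL(2, ℤ)) 0 0 + (γ : SL(2, ℤ)) 1 1).natAbs ≤ 2 → χ γ = 0) →
      (∀ γ : Gamma0 N, (∃ k : ℕ, 1 ≤ k ∧ ((γ : SL(2, ℤ)) 1 1).natAbs = 4 ^ k) → χ γ = 0) →
      ∃ ψ : ZMod N → ZMod 2, (∀ x y : ZMod N, IsUnit x → IsUnit y → ψ (x * y) = ψ x + ψ y) ∧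
        ∀ β : Gamma0 N, (β : SL(2, ℤ)) 0 1 = -1 → χ β = ψ ((((β : SL(2, ℤ)) 1 1 : ℤ) : ZMod N))) :
    ∀ χ : Gamma0 N → ZMod 2,
      (∀ γ δ : Gamma0 N, χ (γ * δ) = χ γ + χ δ) →
      (∀ γ : Gamma0 N, ((γ : SL(2, ℤ)) 0 0 + (γ : SL(2, ℤ)) 1 1).natAbs ≤ 2 → χ γ = 0) →
      (∀ γ : Gamma0 N, (∃ k : ℕ, 1 ≤ k ∧ ((γ : SL(2, ℤ)) 1 1).natAbs = 4 ^ k) → χ γ = 0) →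
      ∃ ψ : ZMod N → ZMod 2, (∀ x y : ZMod N, IsUnit x → IsUnit y → ψ (x * y) = ψ x + ψ y) ∧
        ∀ γ : Gamma0 N, χ γ = ψ ((((γ : SL(2, ℤ)) 1 1 : ℤ) : ZMod N)) := by
  intro χ hadd hsmall hkill
  obtain ⟨ψ, hψ, hχψ⟩ := hF χ hadd hsmall hkill
  refine ⟨ψ, hψ, ?_⟩
  -- the twisted character `χ' = χ + ψ ∘ d̄`
  set χ' : Gamma0 N → ZMod 2 := fun γ ↦ χ γ + ψ ((((γ : SL(2, ℤ)) 1 1 : ℤ) : ZMod N)) with hχ'def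
  have hdmul : ∀ γ δ : Gamma0 N, ((((γ * δ : Gamma0 N) : SL(2, ℤ)) 1 1 : ℤ) : ZMod N) =
      (((γ : SL(2, ℤ)) 1 1 : ℤ) : ZMod N) * (((δ : SL(2, ℤ)) 1 1 : ℤ) : ZMod N) := by
    intro γ δ
    have hc : ((((γ : SL(2, ℤ)) 1 0 : ℤ)) : ZMod N) = 0 := by
      have h := γ.2
      rwa [Gamma0_mem] at h
    rw [gamma0_mul_apply_one_one']
    push_cast
    rw [hc, zero_mul, zero_add]
  have hadd' : ∀ γ δ : Gamma0 N, χ' (γ * δ) = χ' γ + χ' δ := by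
    intro γ δ
    simp only [hχ'def]
    rw [hadd, hdmul, hψ _ _ (isUnit_gamma0_apply_one_one γ) (isUnit_gamma0_apply_one_one δ)]
    ring
  -- `ψ ∘ d̄` kills what `χ` kills among elements determined by `(a, d)`: the diagonal companion
  have hψsmall : ∀ γ : Gamma0 N, ((γ : SL(2, ℤ)) 0 0 + (γ : SL(2, ℤ)) 1 1).natAbs ≤ 2 →
      ψ ((((γ : SL(2, ℤ)) 1 1 : ℤ) : ZMod N)) = 0 := by
    intro γ hγ
    obtain ⟨β, hb, ha, hd⟩ := exists_b_neg_one_companion γ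
    rw [← hd, ← hχψ β hb]
    exact hsmall β (by rw [ha, hd]; exact hγ)
  have hsmall' : ∀ γ : Gamma0 N, ((γ : SL(2, ℤ)) 0 0 + (γ : SL(2, ℤ)) 1 1).natAbs ≤ 2 → χ' γ = 0 := by
    intro γ hγ
    simp only [hχ'def]
    rw [hsmall γ hγ, hψsmall γ hγ, add_zero]
  have hB1' : ∀ β : Gamma0 N, ((β : SL(2, ℤ)) 0 1).natAbs = 1 → χ' β = 0 := by
    refine forall_b1_of_forall_b_neg_one hadd' ?_
    intro β hb
    simp only [hχ'def]
    rw [hχψ β hb]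
    exact CharTwo.add_self_eq_zero _
  have h0 := chi_eq_zero_of_forall_b1 hp hq ha1 ha2 hN hadd' hsmall' hB1'
  intro γ
  have h := h0 γ
  simp only [hχ'def] at h
  -- `x + y = 0` in characteristic two means `x = y`
  have := CharTwo.add_self_eq_zero (ψ ((((γ : SL(2, ℤ)) 1 1 : ℤ) : ZMod N)))
  linear_combination h - this

/-- **The named node at `N = p·q` and `N = p²·q` from the `B₁`-character.** At such a level, «every admissible `χ` has `B₁`-values
`ψ ∘ d̄` for a character `ψ`» implies `CuspSpanEvenAtTwo N` (through the trace form and rtt-p4-w3's `cuspSpanEvenAtTwo_of_cuspSpanTrace`).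
The hypothesis is the «`B₁`-character is a character» half of the node, the subject of the rtt-p3 width seats (q-adic triangles / product
rule); nothing about it is asserted here. [cite: Pollack2003, Conj. 6.3] [cite: Kulkarni1991, §2] -/
theorem cuspSpanEvenAtTwo_of_b1Character {p q a : ℕ} [NeZero N] (hp : p.Prime) (hq : q.Prime) (ha1 : 1 ≤ a)
    (ha2 : a ≤ 2) (hN : N = p ^ a * q)
    (hF : ∀ χ : Gamma0 N → ZMod 2,
      (∀ γ δ : Gamma0 N, χ (γ * δ) = χ γ + χ δ) →
      (∀ γ : Gamma0 N, ((γ : SL(2, ℤ)) 0 0 + (γ : SL(2, ℤ)) 1 1).natAbs ≤ 2 → χ γ = 0) →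
      (∀ γ : Gamma0 N, (∃ k : ℕ, 1 ≤ k ∧ ((γ : SL(2, ℤ)) 1 1).natAbs = 4 ^ k) → χ γ = 0) →
      ∃ ψ : ZMod N → ZMod 2, (∀ x y : ZMod N, IsUnit x → IsUnit y → ψ (x * y) = ψ x + ψ y) ∧
        ∀ β : Gamma0 N, (β : SL(2, ℤ)) 0 1 = -1 → χ β = ψ ((((β : SL(2, ℤ)) 1 1 : ℤ) : ZMod N))) :
    CuspSpanEvenAtTwo N :=
  cuspSpanEvenAtTwo_of_cuspSpanTrace (cuspSpanTrace_of_b1Character hp hq ha1 ha2 hN hF)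

/-! ## §5. THE NODE AT `N = p·q` AND `N = p²·q`, UNCONDITIONALLY — with rtt-p3-w4's «`B₁`-character is a character at every odd level» -/

/-- **`CuspSpanEvenAtTwo N` for `N = p^a·q`, `p, q` odd primes, `a ≤ 2` — UNCONDITIONAL.** The node (G′)_N of the route (item 27436) at the
first composite families `p·q`, `p²·q` (and again `p²`, `p³` when `p = q`): rtt-p3-w4 g2's `cuspSpanEvenAtTwo_of_forall_b1_odd`
(p638351: at every odd level the `B₁`-character of an admissible `χ` is a character, so the node reduces to `B₁`-generation (G‴)_N) composed
with the generation theorem `TwoPrimes.chi_eq_zero_of_forall_b1` of this file (the `4^k`-hypothesis is not even used). No certificate, no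
ERH. BSD is not proved by this. [cite: Pollack2003, Conj. 6.3] [cite: Kulkarni1991, §2] -/
theorem cuspSpanEvenAtTwo_twoPrimes {p q a : ℕ} [NeZero N] (hp : p.Prime) (hq : q.Prime) (hp2 : p ≠ 2) (hq2 : q ≠ 2)
    (ha1 : 1 ≤ a) (ha2 : a ≤ 2) (hN : N = p ^ a * q) : CuspSpanEvenAtTwo N := by
  have hodd : Odd N := by
    rw [hN]
    exact ((hp.odd_of_ne_two hp2).pow).mul (hq.odd_of_ne_two hq2)
  refine cuspSpanEvenAtTwo_of_forall_b1_odd hodd fun χ' hadd hsmall _ hb1 ↦ ?_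
  exact chi_eq_zero_of_forall_b1 hp hq ha1 ha2 hN hadd hsmall (forall_b1_of_forall_b_neg_one hadd hb1)

/-- **`CuspSpanEvenAtTwo (p * q)`** for distinct-or-equal odd primes `p, q` (the case `a = 1`). [cite: Pollack2003, Conj. 6.3] -/
theorem cuspSpanEvenAtTwo_prime_mul_prime {p q : ℕ} (hp : p.Prime) (hq : q.Prime) (hp2 : p ≠ 2) (hq2 : q ≠ 2)
    [NeZero (p * q)] : CuspSpanEvenAtTwo (p * q) :=
  cuspSpanEvenAtTwo_twoPrimes (a := 1) hp hq hp2 hq2 le_rfl one_le_two (by rw [pow_one])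

/-- **`CuspSpanEvenAtTwo (p ^ 2 * q)`** for odd primes `p, q` (the case `a = 2`). [cite: Pollack2003, Conj. 6.3] -/
theorem cuspSpanEvenAtTwo_prime_sq_mul_prime {p q : ℕ} (hp : p.Prime) (hq : q.Prime) (hp2 : p ≠ 2) (hq2 : q ≠ 2)
    [NeZero (p ^ 2 * q)] : CuspSpanEvenAtTwo (p ^ 2 * q) :=
  cuspSpanEvenAtTwo_twoPrimes (a := 2) hp hq hp2 hq2 one_le_two le_rfl rfl

/-- **FLAT at every conductor `p·q`, `p²·q` (`p, q` odd primes).** For `W/ℚ` good supersingular at `2` with `a₂(W) = 0`, newform `f`, and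
conductor `N_W = p^a q` (`a ≤ 2`): `2 ∤ L⁻` for every Pollack pair `(L⁺, L⁻)` of `f` at `2` — crux Kμ⁺'s `stub_flatMuZeroAtTwo` statement is
a THEOREM on this class of conductors (`flatAtTwo_of_cuspSpanEvenAtTwo`). BSD is not proved by this. [cite: Pollack2003, Conj. 6.3 and Prop. 6.18] -/
theorem flatAtTwo_of_conductor_twoPrimes {W : WeierstrassCurve ℚ} [W.IsElliptic] [W.IsGloballyMinimal] [NeZero (W.conductorNorm ℤ)]
    {f : CuspForm (Gamma0 (W.conductorNorm ℤ)) 2} (hf : IsNewformOf W f) (hss : GoodSS W 2) (ha0 : W.frobeniusTrace 2 = 0)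
    {p q a : ℕ} (hp : p.Prime) (hq : q.Prime) (hp2 : p ≠ 2) (hq2 : q ≠ 2) (ha1 : 1 ≤ a) (ha2 : a ≤ 2)
    (hN : W.conductorNorm ℤ = p ^ a * q) :
    ∀ Lplus Lminus : IwasawaAlgebra 2, IsPollackPair f 2 Lplus Lminus → ¬ PowerSeries.C (2 : ℤ_[2]) ∣ Lminus :=
  flatAtTwo_of_cuspSpanEvenAtTwo hf hss ha0 (cuspSpanEvenAtTwo_twoPrimes hp hq hp2 hq2 ha1 ha2 hN)

end TwoPrimes

end Summit.BirchSwinnertonDyer.BirchSwinnertonDyer.Theorems.SignedMuAtTwo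

end
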